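import Literature.NumberTheory.Rogawski1990.LocalStableClassesNonsplitTypeTwoKappa
import Literature.NumberTheory.Rogawski1990.LocalStableClassesNonsplitKappaCount
import HarnessLib

/-!
# `κ_v` as a character on the local class set of a type-(2) torus at a non-split place: the two classes split one–one and the
# `κ`-twisted class count vanishes
# (Rogawski 1990, §3.5 Prop. 3.5.2 (c) p. 29, §3.6 p. 31, §4.3 (4.3.2) p. 43, §4.9 Prop. 4.9.1 p. 55, p. 78)

Topic `NumberTheory/Rogawski1990`; namespace `Literature.NumberTheory.Rogawski1990`.  **THEOREMS ONLY** (no definition, no named fact, no instance,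
no notation, no `sorry`).  Cell `pub/hodgecm-mathlib`, programme P3a, road «D-N7-inert» (inert unit fundamental lemma [Rogawski1990, Prop. 4.9.1 (b)],
map §3 (L4)∕§5 (D5)), brick **(D5)-JUNCTION «κ_H AS A CHARACTER ON THE LOCAL CLASS SET», TYPE (2)** — the sibling of ★ `LocalStableClassesNonsplitKappaCount`
(type (1): four classes, 2 + 2): junction of ★ `LocalStableClassesNonsplitTypeTwoCount` ∕ ★ `LocalStableClassesNonsplitTypeTwoKappa` (B-p14: for `γ′` with a
block frame `γ′ P = P · [A 0; 0 u]`, `χ_A` irreducible — torus `T_K × E¹`, type (2) of [§3.6] — the local stable class has TWO classes, told apart by `κ_v`: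
★ `ncard_conjClassesIn_eq_two`, ★ `finKappaAt_eq_iff_isConj`, ★ `exists_isStablyConj_finKappaAt_eq_neg`) with the class-function heads of ★
`LocalStableClassesNonsplitKappaCount` §1 (F0P3-p02).  Seat F0P3-p02 (g11); LEAD F0P3a-plan (g9) WORD T8-25 (D) («type (2) twin over B-p14's 2b when ★»).
HONEST LABEL: HC_CM is proved only modulo the printed citations until rung 0 closes; this file is unconditional local algebra.

THE PRINT.  [§3.5 Prop. 3.5.2 (c) p. 29; §3.6 p. 31]: type (2) `T = T_K × E¹`, `r = 2`, `|𝓡(T∕F)| = 2^{2−1} = 2`; [p. 78] «type (2): the unique non-trivial `κ`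
corresponds to `H`»; [§4.3 (4.3.2) p. 43]: `Δ(γ_H, γ″) = Δ(γ_H, γ′) κ(inv(γ′, γ″))`.  Hence on the two classes `κ_v(γ_H, ·)` takes the values `κ_v(γ_H, γ′)` and
`−κ_v(γ_H, γ′)` once each, and `Σ_{c ⊂ 𝒪_st(γ′)} κ_v(γ_H, c) = 0`.

WHAT IS PROVED (CM carriers and binders VERBATIM as ★ `LocalStableClassesNonsplitTypeTwoKappa`: `(w) (hw) (h : IsLocalNormPair L H′ v a b) (hu) (hH) (hHd)
(e : Fin 2 ⊕ Fin 1 ≃ Fin 3) {P} {A} (hP : γ′ P = P · reindex e e [A 0; 0 u]) (hA : Irreducible χ_A)`; classes `c : ConjClasses U(H′_v)(F_v)` inside ★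
`conjClassesIn σ H′_v ⟨b, _⟩`, elements read in `G′_v` as `⟨δ.val, δ.2⟩` (same carrier); same head SHAPES as the ★ type-(1) file so that the (L3)∕(L5)
reader consumes both torus types uniformly): `exists_conjClassesIn_eq_two_finKappaAt` (the two classes `⟦γ′⟧, ⟦δ₀⟧` and their signs),
**`ncard_conjClassesIn_sep_finKappaAt_eq_eq_one_of_blockFrame`**, **`ncard_conjClassesIn_sep_finKappaAt_eq_neg_one_of_blockFrame`**,
**`finsum_mem_conjClassesIn_finKappaAt_out_eq_zero_of_blockFrame`**.

## References
* [Rogawski1990] J. D. Rogawski, *Automorphic Representations of Unitary Groups in Three Variables*, Ann. of Math. Stud. 123 (1990), §3.1 p. 19,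
  §3.5 Prop. 3.5.2 (c) p. 29, §3.6 p. 31, §4.3 (4.3.2) p. 43, §4.9 Prop. 4.9.1 p. 55, p. 78.
* [LanglandsShelstad1987] R. P. Langlands, D. Shelstad, *On the definition of transfer factors*, Math. Ann. 278 (1987), §1.
* [Kottwitz1986] R. E. Kottwitz, *Stable trace formula: elliptic singular terms*, Math. Ann. 275 (1986), §7.
-/

set_option autoImplicit false

noncomputable section

open NumberField IsDedekindDomain Matrix
open scoped MatrixGroups

namespace Literature.NumberTheory.Rogawski1990

open Literature.NumberTheory.Automorphic Literature.NumberTheory.Automorphic.UnitaryGroup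
open Literature.AlgebraicGeometry.ShimuraVarieties (unitaryGroup)

/-- `⟦out c⟧ = c` for conjugacy classes. [folklore] -/
private theorem mk_out_eq' {G : Type*} [Monoid G] (c : ConjClasses G) : ConjClasses.mk (Quotient.out c) = c := by
  rw [← ConjClasses.quotient_mk_eq_mk]
  exact Quotient.out_eq c

/-- A CM field has a non-zero element negated by complex conjugation. [cite: Rogawski1990, §1.10] -/
private theorem exists_complexConj_eq_neg_ne_zero'' (L : Type) [Field L] [NumberField L] [IsCMField L] :
    ∃ δ : L, IsCMField.complexConj L δ = -δ ∧ δ ≠ 0 := by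
  obtain ⟨ζ, hζ⟩ := not_forall.1 fun h0 => IsCMField.complexConj_ne_one L (AlgEquiv.ext h0)
  refine ⟨ζ - IsCMField.complexConj L ζ, by rw [map_sub, IsCMField.complexConj_apply_apply, neg_sub], fun h0 => hζ ?_⟩
  rw [sub_eq_zero] at h0
  exact h0.symm

section TypeTwo

variable (L : Type) [Field L] [NumberField L] [IsCMField L] (v : HeightOneSpectrum (𝓞 ↥(maximalRealSubfield L)))
  (H' : Matrix (Fin 3) (Fin 3) L)
  (a : (UnitaryGroup.cmDatum L 2 (Matrix.of fun i j : Fin 2 => if i.val + j.val + 1 = 2 then (1 : L) else 0)).Local v ×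
      (UnitaryGroup.cmDatum L 1 (Matrix.of fun i j : Fin 1 => if i.val + j.val + 1 = 1 then (1 : L) else 0)).Local v)
  (b : (UnitaryGroup.cmDatum L 3 H').Local v)

/-- **THE TWO CLASSES AND THEIR SIGNS** (type (2), non-split `v`): for a match `γ′ = b` with a block frame (`χ_A` irreducible) the local stable class of `γ′`
consists of TWO distinct classes `⟦γ′⟧`, `⟦δ₀⟧` of `U(H′_v)(F_v)`, with `κ_v(γ_H, ·) = κ_v(γ_H, γ′)` on `⟦γ′⟧` and `= −κ_v(γ_H, γ′)` on `⟦δ₀⟧` (★ B-p14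
`ncard_conjClassesIn_eq_two` + ★ `exists_isStablyConj_finKappaAt_eq_neg` + the class-function head ★ `finKappaAt_eq_of_mk_eq_mk`).
[cite: Rogawski1990, §3.5 Prop. 3.5.2 (c) p. 29; §4.3 (4.3.2) p. 43; §4.9 Prop. 4.9.1 p. 55] -/
theorem exists_conjClassesIn_eq_two_finKappaAt (w : UnitaryGroup.PlacesOver L v) (hw : IsCMField.complexConj L • w.1 = w.1)
    (h : IsLocalNormPair L H' v a b) (hu : IsUnit ((finCharpolyTwo L v a).eval (finGammaTwo L v a)))
    (hH : (((UnitaryGroup.adelicForm L 3 H').map (UnitaryGroup.adeleToLocal L v)).map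
      (UnitaryGroup.conjLocal L (IsCMField.complexConj L) v))ᵀ = (UnitaryGroup.adelicForm L 3 H').map (UnitaryGroup.adeleToLocal L v))
    (hHd : IsUnit ((UnitaryGroup.adelicForm L 3 H').map (UnitaryGroup.adeleToLocal L v)).det) (e : Fin 2 ⊕ Fin 1 ≃ Fin 3)
    {P : GL (Fin 3) (UnitaryGroup.LocalRing L v)} {A : Matrix (Fin 2) (Fin 2) (UnitaryGroup.LocalRing L v)}
    (hP : (b.val.val : Matrix (Fin 3) (Fin 3) (UnitaryGroup.LocalRing L v)) * P.val = P.val * reindex e e (fromBlocks A 0 0 !![finGammaTwo L v a]))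
    (hA : Irreducible A.charpoly) :
    ∃ c₀ c₁, conjClassesIn (UnitaryGroup.conjLocal L (IsCMField.complexConj L) v)
          ((UnitaryGroup.adelicForm L 3 H').map (UnitaryGroup.adeleToLocal L v)) ⟨b.val, b.2⟩ = {c₀, c₁} ∧ c₀ ≠ c₁ ∧
      (∀ δ, ConjClasses.mk δ = c₀ → finKappaAt L v H' a ⟨δ.val, δ.2⟩ = finKappaAt L v H' a b) ∧
      (∀ δ, ConjClasses.mk δ = c₁ → finKappaAt L v H' a ⟨δ.val, δ.2⟩ = -finKappaAt L v H' a b) := by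
  obtain ⟨δ₁, hcδ, hδ⟩ := exists_complexConj_eq_neg_ne_zero'' L
  obtain ⟨δ₀, hst₀, hnc, hκ₀⟩ := exists_isStablyConj_finKappaAt_eq_neg L v H' a b w hw h hu hH hHd e hP hA
  obtain ⟨g₀, hg₀⟩ := isStablyConj_iff.1 hst₀
  have hn₀ : IsLocalNormPair L H' v a δ₀ := isLocalNormPair_of_conj_eq L v H' a b δ₀ h hg₀
  have hS2 : (conjClassesIn (UnitaryGroup.conjLocal L (IsCMField.complexConj L) v)
          ((UnitaryGroup.adelicForm L 3 H').map (UnitaryGroup.adeleToLocal L v)) ⟨b.val, b.2⟩).ncard = 2 := ncard_conjClassesIn_eq_two L v (IsCMField.complexConj L) hcδ hδ e w hw hH hHd b.2 hP hA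
  have hSfin : (conjClassesIn (UnitaryGroup.conjLocal L (IsCMField.complexConj L) v)
          ((UnitaryGroup.adelicForm L 3 H').map (UnitaryGroup.adeleToLocal L v)) ⟨b.val, b.2⟩).Finite := finite_conjClassesIn_of_blockFrame L v (IsCMField.complexConj L) hcδ hδ e w hw hH hHd b.2 hP hA
  have hne : ConjClasses.mk _ ≠ ConjClasses.mk _ := fun h0 => hnc (ConjClasses.mk_eq_mk_iff_isConj.1 h0)
  have hsub := Set.insert_subset (mk_mem_conjClassesIn_self _) (Set.singleton_subset_iff.2 (mk_mem_conjClassesIn_iff.2 hst₀))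
  have heq := Set.eq_of_subset_of_ncard_le hsub (by rw [hS2, Set.ncard_pair hne]) hSfin
  refine ⟨_, _, heq.symm, hne, fun δ' hmk => ?_, fun δ' hmk => ?_⟩
  · exact finKappaAt_eq_of_mk_eq_mk L v H' a h hmk.symm
  · exact (finKappaAt_eq_of_mk_eq_mk L v H' a hn₀ hmk.symm).trans hκ₀

/-- **`κ_v` SPLITS THE TWO CLASSES OF A TYPE-(2) LOCAL STABLE CLASS ONE–ONE: the class carrying `κ_v(γ_H, γ′)`** — the type-(2) twin of ★
`ncard_conjClassesIn_sep_finKappaAt_eq_eq_two` (same head shape, `2 ↦ 1`): `κ_v(γ_H, ·)` is the non-trivial character of `𝓔(T_K × E¹∕F_v) ≅ ℤ∕2`.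
[cite: Rogawski1990, §3.5 Prop. 3.5.2 (c) p. 29; §4.3 (4.3.2) p. 43; §4.9 Prop. 4.9.1 p. 55] -/
theorem ncard_conjClassesIn_sep_finKappaAt_eq_eq_one_of_blockFrame (w : UnitaryGroup.PlacesOver L v) (hw : IsCMField.complexConj L • w.1 = w.1)
    (h : IsLocalNormPair L H' v a b) (hu : IsUnit ((finCharpolyTwo L v a).eval (finGammaTwo L v a)))
    (hH : (((UnitaryGroup.adelicForm L 3 H').map (UnitaryGroup.adeleToLocal L v)).map
      (UnitaryGroup.conjLocal L (IsCMField.complexConj L) v))ᵀ = (UnitaryGroup.adelicForm L 3 H').map (UnitaryGroup.adeleToLocal L v))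
    (hHd : IsUnit ((UnitaryGroup.adelicForm L 3 H').map (UnitaryGroup.adeleToLocal L v)).det) (e : Fin 2 ⊕ Fin 1 ≃ Fin 3)
    {P : GL (Fin 3) (UnitaryGroup.LocalRing L v)} {A : Matrix (Fin 2) (Fin 2) (UnitaryGroup.LocalRing L v)}
    (hP : (b.val.val : Matrix (Fin 3) (Fin 3) (UnitaryGroup.LocalRing L v)) * P.val = P.val * reindex e e (fromBlocks A 0 0 !![finGammaTwo L v a]))
    (hA : Irreducible A.charpoly) :
    {x ∈ conjClassesIn (UnitaryGroup.conjLocal L (IsCMField.complexConj L) v)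
          ((UnitaryGroup.adelicForm L 3 H').map (UnitaryGroup.adeleToLocal L v)) ⟨b.val, b.2⟩ |
        ∀ δ, ConjClasses.mk δ = x → finKappaAt L v H' a ⟨δ.val, δ.2⟩ = finKappaAt L v H' a b}.ncard = 1 := by
  obtain ⟨c₀, c₁, hS, h01, hκ₀, hκ₁⟩ := exists_conjClassesIn_eq_two_finKappaAt L v H' a b w hw h hu hH hHd e hP hA
  have hsign := finKappaAt_eq_one_or_eq_neg_one_of_isUnit L v H' a b h hu
  have hne : -finKappaAt L v H' a b ≠ finKappaAt L v H' a b := by rcases hsign with h1 | h1 <;> rw [h1] <;> decide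
  have hset : {x ∈ conjClassesIn (UnitaryGroup.conjLocal L (IsCMField.complexConj L) v)
          ((UnitaryGroup.adelicForm L 3 H').map (UnitaryGroup.adeleToLocal L v)) ⟨b.val, b.2⟩ |
        ∀ δ, ConjClasses.mk δ = x → finKappaAt L v H' a ⟨δ.val, δ.2⟩ = finKappaAt L v H' a b} = {c₀} := by
    ext x
    simp only [hS, Set.mem_insert_iff, Set.mem_singleton_iff, Set.mem_setOf_eq]
    constructor
    · rintro ⟨hx | hx, hκ⟩
      · exact hx
      · exact absurd ((hκ₁ _ (hx ▸ mk_out_eq' x)).symm.trans (hκ _ (mk_out_eq' x))) hne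
    · rintro rfl
      exact ⟨Or.inl rfl, hκ₀⟩
  rw [hset, Set.ncard_singleton]

/-- **… and the class carrying the OPPOSITE sign** (type-(2) twin of ★ `ncard_conjClassesIn_sep_finKappaAt_eq_neg_two`, `2 ↦ 1`).
[cite: Rogawski1990, §3.5 Prop. 3.5.2 (c) p. 29; §4.3 (4.3.2) p. 43; §4.9 Prop. 4.9.1 p. 55] -/
theorem ncard_conjClassesIn_sep_finKappaAt_eq_neg_one_of_blockFrame (w : UnitaryGroup.PlacesOver L v) (hw : IsCMField.complexConj L • w.1 = w.1)
    (h : IsLocalNormPair L H' v a b) (hu : IsUnit ((finCharpolyTwo L v a).eval (finGammaTwo L v a)))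
    (hH : (((UnitaryGroup.adelicForm L 3 H').map (UnitaryGroup.adeleToLocal L v)).map
      (UnitaryGroup.conjLocal L (IsCMField.complexConj L) v))ᵀ = (UnitaryGroup.adelicForm L 3 H').map (UnitaryGroup.adeleToLocal L v))
    (hHd : IsUnit ((UnitaryGroup.adelicForm L 3 H').map (UnitaryGroup.adeleToLocal L v)).det) (e : Fin 2 ⊕ Fin 1 ≃ Fin 3)
    {P : GL (Fin 3) (UnitaryGroup.LocalRing L v)} {A : Matrix (Fin 2) (Fin 2) (UnitaryGroup.LocalRing L v)}
    (hP : (b.val.val : Matrix (Fin 3) (Fin 3) (UnitaryGroup.LocalRing L v)) * P.val = P.val * reindex e e (fromBlocks A 0 0 !![finGammaTwo L v a]))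
    (hA : Irreducible A.charpoly) :
    {x ∈ conjClassesIn (UnitaryGroup.conjLocal L (IsCMField.complexConj L) v)
          ((UnitaryGroup.adelicForm L 3 H').map (UnitaryGroup.adeleToLocal L v)) ⟨b.val, b.2⟩ |
        ∀ δ, ConjClasses.mk δ = x → finKappaAt L v H' a ⟨δ.val, δ.2⟩ = -finKappaAt L v H' a b}.ncard = 1 := by
  obtain ⟨c₀, c₁, hS, h01, hκ₀, hκ₁⟩ := exists_conjClassesIn_eq_two_finKappaAt L v H' a b w hw h hu hH hHd e hP hA
  have hsign := finKappaAt_eq_one_or_eq_neg_one_of_isUnit L v H' a b h hu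
  have hne : finKappaAt L v H' a b ≠ -finKappaAt L v H' a b := by rcases hsign with h1 | h1 <;> rw [h1] <;> decide
  have hset : {x ∈ conjClassesIn (UnitaryGroup.conjLocal L (IsCMField.complexConj L) v)
          ((UnitaryGroup.adelicForm L 3 H').map (UnitaryGroup.adeleToLocal L v)) ⟨b.val, b.2⟩ |
        ∀ δ, ConjClasses.mk δ = x → finKappaAt L v H' a ⟨δ.val, δ.2⟩ = -finKappaAt L v H' a b} = {c₁} := by
    ext x
    simp only [hS, Set.mem_insert_iff, Set.mem_singleton_iff, Set.mem_setOf_eq]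
    constructor
    · rintro ⟨hx | hx, hκ⟩
      · exact absurd ((hκ₀ _ (hx ▸ mk_out_eq' x)).symm.trans (hκ _ (mk_out_eq' x))) hne
      · exact hx
    · rintro rfl
      exact ⟨Or.inr rfl, hκ₁⟩
  rw [hset, Set.ncard_singleton]

/-- **THE `κ_v`-TWISTED COUNT OF THE TWO CLASSES VANISHES** (type (2), non-split `v`): `Σ_{c ⊂ 𝒪_st(γ′)} κ_v(γ_H, out c) = κ − κ = 0` — the type-(2) twin of ★
`finsum_mem_conjClassesIn_finKappaAt_out_eq_zero`. [cite: Rogawski1990, §3.5 Prop. 3.5.2 (c) p. 29; §4.3 (4.3.2) p. 43; §4.9 Prop. 4.9.1 p. 55] -/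
theorem finsum_mem_conjClassesIn_finKappaAt_out_eq_zero_of_blockFrame (w : UnitaryGroup.PlacesOver L v) (hw : IsCMField.complexConj L • w.1 = w.1)
    (h : IsLocalNormPair L H' v a b) (hu : IsUnit ((finCharpolyTwo L v a).eval (finGammaTwo L v a)))
    (hH : (((UnitaryGroup.adelicForm L 3 H').map (UnitaryGroup.adeleToLocal L v)).map
      (UnitaryGroup.conjLocal L (IsCMField.complexConj L) v))ᵀ = (UnitaryGroup.adelicForm L 3 H').map (UnitaryGroup.adeleToLocal L v))
    (hHd : IsUnit ((UnitaryGroup.adelicForm L 3 H').map (UnitaryGroup.adeleToLocal L v)).det) (e : Fin 2 ⊕ Fin 1 ≃ Fin 3)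
    {P : GL (Fin 3) (UnitaryGroup.LocalRing L v)} {A : Matrix (Fin 2) (Fin 2) (UnitaryGroup.LocalRing L v)}
    (hP : (b.val.val : Matrix (Fin 3) (Fin 3) (UnitaryGroup.LocalRing L v)) * P.val = P.val * reindex e e (fromBlocks A 0 0 !![finGammaTwo L v a]))
    (hA : Irreducible A.charpoly) :
    ∑ᶠ x ∈ conjClassesIn (UnitaryGroup.conjLocal L (IsCMField.complexConj L) v)
          ((UnitaryGroup.adelicForm L 3 H').map (UnitaryGroup.adeleToLocal L v)) ⟨b.val, b.2⟩,
        finKappaAt L v H' a ⟨(Quotient.out x).val, (Quotient.out x).2⟩ = 0 := by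
  obtain ⟨c₀, c₁, hS, h01, hκ₀, hκ₁⟩ := exists_conjClassesIn_eq_two_finKappaAt L v H' a b w hw h hu hH hHd e hP hA
  rw [hS, finsum_mem_pair h01, hκ₀ _ (mk_out_eq' c₀), hκ₁ _ (mk_out_eq' c₁)]
  ring

end TypeTwo

end Literature.NumberTheory.Rogawski1990
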